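import Summits.CriticalPhenomena.CardyFormulaZ2.Theorems.CardyIKTransportCornerLineDescentSyndromeBiasCharacters

/-!
# Syndrome bias, part 2/5: level sets of the row/column parities

Support file for `stub_SyndromeBias` (stmt-CriticalPhenomena-10964): the level-set identities (M1)–(M2)
(`levP_eq`, `levB_eq`: probability and `f`-bias of a level set as character sums), the bound (M3) on the twisted
expectations, the odd-character sum bound (M4) `T_le` and the level-probability lower bound (M5) `ZP_ge`.
-/

noncomputable section

namespace Summit.CriticalPhenomena.CardyFormulaZ2.Theorems.CornerLineDescent.SymmetricSeed

open scoped BigOperators Classical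
open Finset

/-- ANCHOR OF PART 2 (proposed registered sub-goal; Mathlib-only signature). Binomial theorem over subsets: `Σ_{I ⊆
s} t^{#I} = (1+t)^{#s}` — the product form of the character-sum dominators. [folklore] -/
theorem sum_pow_card_powerset : ∀ (t : ℝ) (s : Finset ℤ), ∑ I ∈ s.powerset, t ^ I.card = (1 + t) ^ s.card := by
  intro t s
  have := Finset.sum_pow_mul_eq_add_pow t 1 s
  simp only [one_pow, mul_one] at this
  rw [this, add_comm]

namespace SyndromeBias

/-- `Σ_{I ⊆ s} t^{#(s∖I)} = (1+t)^{#s}`. [folklore] -/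
theorem sum_pow_card_sdiff (t : ℝ) (s : Finset ℤ) :
    ∑ I ∈ s.powerset, t ^ #(s \ I) = (1 + t) ^ #s := by
  have := Finset.sum_pow_mul_eq_add_pow 1 t s
  simp only [one_pow, one_mul] at this
  rw [← this]
  refine Finset.sum_congr rfl fun I hI => ?_
  rw [Finset.card_sdiff_of_subset (Finset.mem_powerset.1 hI)]

/-- `Σ_{I ⊆ R', J ⊆ C'} t^{#I+#J} = (1+t)^{#R'}(1+t)^{#C'}`. [folklore] -/
theorem sum_sum_pow (t : ℝ) (R' C' : Finset ℤ) :
    ∑ I ∈ R'.powerset, ∑ J ∈ C'.powerset, t ^ (#I + #J) = (1 + t) ^ #R' * (1 + t) ^ #C' := by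
  rw [← sum_pow_card_powerset, ← sum_pow_card_powerset, Finset.sum_mul_sum]
  refine Finset.sum_congr rfl fun I _ => Finset.sum_congr rfl fun J _ => ?_
  rw [pow_add]

/-- `Σ_{I ⊆ R', J ⊆ C'} t^{#(R'∖I)+#(C'∖J)} = (1+t)^{#R'}(1+t)^{#C'}`. [folklore] -/
theorem sum_sum_pow_sdiff (t : ℝ) (R' C' : Finset ℤ) :
    ∑ I ∈ R'.powerset, ∑ J ∈ C'.powerset, t ^ (#(R' \ I) + #(C' \ J)) =
      (1 + t) ^ #R' * (1 + t) ^ #C' := by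
  rw [← sum_pow_card_sdiff, ← sum_pow_card_sdiff, Finset.sum_mul_sum]
  refine Finset.sum_congr rfl fun I _ => Finset.sum_congr rfl fun J _ => ?_
  rw [pow_add]

/-- The product Bernoulli weight `p^{#X}(1-p)^{#s-#X}` of the pattern `X ⊆ s`. [folklore] -/
def wt (p : ℝ) (s X : Finset (ℤ × ℤ)) : ℝ := p ^ #X * (1 - p) ^ (#s - #X)

/-- Weights are nonnegative for `p ∈ [0,1]`. [folklore] -/
theorem wt_nonneg {p : ℝ} (hp0 : 0 ≤ p) (hp1 : p ≤ 1) (s X : Finset (ℤ × ℤ)) : 0 ≤ wt p s X := by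
  unfold wt
  have : 0 ≤ 1 - p := by linarith
  positivity

/-- The level set of `X₀`: patterns on `R × C` with the same row and column parities as `X₀`. [folklore] -/
def lev (R C : Finset ℤ) (X₀ : Finset (ℤ × ℤ)) : Finset (Finset (ℤ × ℤ)) :=
  (R ×ˢ C).powerset.filter fun X =>
    (∀ i ∈ R, rsign i X = rsign i X₀) ∧ ∀ j ∈ C, csign j X = csign j X₀

/-- The value `sg(I,J) = ∏_{i∈I} rsign i X₀ ∏_{j∈J} csign j X₀ = χ_{I,J}(X₀)` of the character on the level.
[folklore] -/
def sg (X₀ : Finset (ℤ × ℤ)) (I J : Finset ℤ) : ℝ := (∏ i ∈ I, rsign i X₀) * ∏ j ∈ J, csign j X₀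

/-- `|sg| = 1`. [folklore] -/
theorem abs_sg (X₀ : Finset (ℤ × ℤ)) (I J : Finset ℤ) : |sg X₀ I J| = 1 := by
  unfold sg
  rw [abs_mul, Finset.abs_prod, Finset.abs_prod]
  rw [Finset.prod_eq_one (fun i _ => ?_), Finset.prod_eq_one (fun j _ => ?_), one_mul]
  · rcases csign_eq_or j X₀ with h | h <;> rw [h] <;> norm_num
  · rcases rsign_eq_or i X₀ with h | h <;> rw [h] <;> norm_num

/-- Exchange of the pattern sum with the character double sum. [folklore] -/
theorem sum_exchange (S : Finset (Finset (ℤ × ℤ))) (R C : Finset ℤ) (w : Finset (ℤ × ℤ) → ℝ)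
    (s : Finset ℤ → Finset ℤ → ℝ) (c : Finset ℤ → Finset ℤ → Finset (ℤ × ℤ) → ℝ) :
    ∑ X ∈ S, w X * ∑ I ∈ R.powerset, ∑ J ∈ C.powerset, s I J * c I J X =
      ∑ I ∈ R.powerset, ∑ J ∈ C.powerset, s I J * ∑ X ∈ S, w X * c I J X := by
  simp_rw [Finset.mul_sum]
  rw [Finset.sum_comm]
  refine Finset.sum_congr rfl fun I _ => ?_
  rw [Finset.sum_comm]
  refine Finset.sum_congr rfl fun J _ => Finset.sum_congr rfl fun X _ => ?_
  ring

/-- (M1) `2^{#R+#C} P[level of X₀] = Σ_{I,J} sg(I,J) ρ^{w(I,J)}`. [folklore] -/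
theorem levP_eq (p : ℝ) (R C : Finset ℤ) (X₀ : Finset (ℤ × ℤ)) :
    2 ^ #R * 2 ^ #C * ∑ X ∈ lev R C X₀, wt p (R ×ˢ C) X =
      ∑ I ∈ R.powerset, ∑ J ∈ C.powerset, sg X₀ I J * (1 - 2 * p) ^ wN R C I J := by
  unfold lev
  rw [Finset.sum_filter, Finset.mul_sum]
  have h1 : ∀ X ∈ (R ×ˢ C).powerset,
      2 ^ #R * 2 ^ #C * (if (∀ i ∈ R, rsign i X = rsign i X₀) ∧ ∀ j ∈ C, csign j X = csign j X₀
        then wt p (R ×ˢ C) X else 0) =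
      wt p (R ×ˢ C) X * ∑ I ∈ R.powerset, ∑ J ∈ C.powerset, sg X₀ I J * chi I J X := by
    intro X _
    unfold sg
    rw [sum_sg_chi]
    split_ifs <;> ring
  rw [Finset.sum_congr rfl h1, sum_exchange]
  refine Finset.sum_congr rfl fun I _ => Finset.sum_congr rfl fun J _ => ?_
  unfold wt
  rw [sum_wt_chi]

/-- (M2) `2^{#R+#C} (P[f ∈ X, level] - p P[level]) = Σ_{I,J} sg(I,J) B_{I,J}` with the twisted expectations
`B_{I,J}`. [folklore] -/
theorem levB_eq (p : ℝ) (R C : Finset ℤ) (X₀ : Finset (ℤ × ℤ)) {f : ℤ × ℤ} (hf : f ∈ R ×ˢ C) :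
    2 ^ #R * 2 ^ #C * ∑ X ∈ lev R C X₀, wt p (R ×ˢ C) X * ((if f ∈ X then 1 else 0) - p) =
      ∑ I ∈ R.powerset, ∑ J ∈ C.powerset, sg X₀ I J *
        (p * (1 - p) * (eps I J f - 1) * ∏ c ∈ (R ×ˢ C).erase f, (p * eps I J c + (1 - p))) := by
  unfold lev
  rw [Finset.sum_filter, Finset.mul_sum]
  have h1 : ∀ X ∈ (R ×ˢ C).powerset,
      2 ^ #R * 2 ^ #C * (if (∀ i ∈ R, rsign i X = rsign i X₀) ∧ ∀ j ∈ C, csign j X = csign j X₀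
        then wt p (R ×ˢ C) X * ((if f ∈ X then 1 else 0) - p) else 0) =
      (wt p (R ×ˢ C) X * ((if f ∈ X then 1 else 0) - p)) *
        ∑ I ∈ R.powerset, ∑ J ∈ C.powerset, sg X₀ I J * chi I J X := by
    intro X _
    unfold sg
    rw [sum_sg_chi]
    split_ifs <;> ring
  rw [Finset.sum_congr rfl h1, sum_exchange]
  refine Finset.sum_congr rfl fun I _ => Finset.sum_congr rfl fun J _ => ?_
  unfold wt chi
  rw [← sum_wt_ind_chi p (R ×ˢ C) (eps I J) hf]
  congr 1
  refine Finset.sum_congr rfl fun X _ => ?_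
  ring

/-- (M3) `|B_{I,J}| ≤ 2p(1-p) ρ̄^{w-1}` for characters odd at `f`, and `B_{I,J} = 0` for the others. [folklore] -/
theorem absB_le {p : ℝ} (hp0 : 0 ≤ p) (hp1 : p ≤ 1) (R C : Finset ℤ) {f : ℤ × ℤ}
    (hf : f ∈ R ×ˢ C) (I J : Finset ℤ) :
    |p * (1 - p) * (eps I J f - 1) * ∏ c ∈ (R ×ˢ C).erase f, (p * eps I J c + (1 - p))| ≤
      2 * (p * (1 - p)) *
        (if (f.1 ∈ I ↔ f.2 ∈ J) then 0 else |1 - 2 * p| ^ (wN R C I J - 1)) := by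
  have hp' : 0 ≤ 1 - p := by linarith
  by_cases h : (f.1 ∈ I ↔ f.2 ∈ J)
  · rw [if_pos h]
    have : eps I J f = 1 := by unfold eps; rw [if_pos h]
    rw [this]
    simp
  · rw [if_neg h]
    have hf1 : eps I J f = -1 := by unfold eps; rw [if_neg h]
    rw [hf1, abs_mul, Finset.abs_prod]
    have h2 : ∀ c ∈ (R ×ˢ C).erase f, |p * eps I J c + (1 - p)| =
        if (c.1 ∈ I ↔ c.2 ∈ J) then 1 else |1 - 2 * p| := by
      intro c _
      unfold eps
      split_ifs
      · rw [mul_one, add_sub_cancel, abs_one]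
      · congr 1; ring
    rw [Finset.prod_congr rfl h2, Finset.prod_ite, Finset.prod_const_one, Finset.prod_const,
      one_mul, Finset.filter_erase, Finset.card_erase_of_mem]
    · rw [abs_of_nonpos (by nlinarith), show wN R C I J = #((R ×ˢ C).filter
        fun c => ¬ (c.1 ∈ I ↔ c.2 ∈ J)) from rfl]
      nlinarith [pow_nonneg (abs_nonneg (1 - 2 * p))
        (#((R ×ˢ C).filter fun c => ¬ (c.1 ∈ I ↔ c.2 ∈ J)) - 1), mul_nonneg hp0 hp']
    · exact Finset.mem_filter.2 ⟨hf, h⟩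

/-- (M4) The odd-at-`f` character sum: `Σ_{(I,J) odd at f} ρ̄^{w-1} ≤ 4 ρ̄^{2r} (1 + ρ̄^{r-1})^{4r}` (the two
leading characters are the row and the column of `f`). [folklore] -/
theorem T_le {R C : Finset ℤ} {r : ℕ} (hR : #R = 2 * r + 1) (hC : #C = 2 * r + 1)
    {f : ℤ × ℤ} (hf : f ∈ R ×ˢ C) {ρ : ℝ} (h0 : 0 ≤ ρ) (h1 : ρ ≤ 1) :
    ∑ I ∈ R.powerset, ∑ J ∈ C.powerset,
        (if (f.1 ∈ I ↔ f.2 ∈ J) then (0 : ℝ) else ρ ^ (wN R C I J - 1)) ≤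
      4 * ρ ^ (2 * r) * (1 + ρ ^ (r - 1)) ^ (4 * r) := by
  obtain ⟨hi₀, hj₀⟩ := Finset.mem_product.1 hf
  set R' := R.erase f.1 with hR'
  set C' := C.erase f.2 with hC'
  have hi : f.1 ∉ R' := Finset.notMem_erase f.1 R
  have hj : f.2 ∉ C' := Finset.notMem_erase f.2 C
  have hRi : insert f.1 R' = R := Finset.insert_erase hi₀
  have hCj : insert f.2 C' = C := Finset.insert_erase hj₀
  have hR'c : #R' = 2 * r := by rw [hR', Finset.card_erase_of_mem hi₀, hR]; rfl
  have hC'c : #C' = 2 * r := by rw [hC', Finset.card_erase_of_mem hj₀, hC]; rfl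
  rw [sum_powerset_insert₂ hRi hCj hi hj]
  set x := ρ ^ (r - 1) with hx
  calc _ ≤ ∑ I ∈ R'.powerset, ∑ J ∈ C'.powerset,
        2 * ρ ^ (2 * r) * (x ^ (#I + #J) + x ^ (#(R' \ I) + #(C' \ J))) := by
        refine Finset.sum_le_sum fun I hI => Finset.sum_le_sum fun J hJ => ?_
        have hIR' : I ⊆ R' := Finset.mem_powerset.1 hI
        have hJC' : J ⊆ C' := Finset.mem_powerset.1 hJ
        have hiI : f.1 ∉ I := fun h => hi (hIR' h)
        have hjJ : f.2 ∉ J := fun h => hj (hJC' h)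
        obtain ⟨-, h2, h3, -⟩ := wN_four hi₀ hj₀ hIR' hJC'
        have ha : #I + #(R' \ I) = 2 * r := by
          rw [add_comm, Finset.card_sdiff_add_card_eq_card hIR', hR'c]
        have hb : #J + #(C' \ J) = 2 * r := by
          rw [add_comm, Finset.card_sdiff_add_card_eq_card hJC', hC'c]
        rw [if_pos (by simp [hiI, hjJ]), if_neg (by simp [hiI, hjJ]), if_neg (by simp [hiI, hjJ]),
          if_pos (by simp [hiI, hjJ]), zero_add, add_zero]
        rw [← hR', ← hC'] at h2 h3
        rw [h2, h3]
        have e2 := pw2 h0 h1 ha hb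
        have e3 := pw2 h0 h1 hb ha
        rw [show (#J + 1) * (#(R' \ I) + 1) + #(C' \ J) * #I =
          #I * #(C' \ J) + (#(R' \ I) + 1) * (#J + 1) by ring] at e3
        rw [← hx] at e2 e3
        rw [show #J + #I = #I + #J by ring, show #(C' \ J) + #(R' \ I) = #(R' \ I) + #(C' \ J)
          by ring] at e3
        linarith
    _ = 4 * ρ ^ (2 * r) * (1 + ρ ^ (r - 1)) ^ (4 * r) := by
        rw [← hx]
        simp_rw [mul_add]
        rw [Finset.sum_congr rfl fun I _ => Finset.sum_add_distrib, Finset.sum_add_distrib]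
        simp_rw [← Finset.mul_sum]
        rw [sum_sum_pow, sum_sum_pow_sdiff, hR'c, hC'c, ← pow_add,
          show 2 * r + 2 * r = 4 * r by ring]
        ring

/-- `Σ_{I ⊆ s} 1[I = ∅] = 1`. [folklore] -/
theorem ite_empty_sum (s : Finset ℤ) :
    ∑ I ∈ s.powerset, (if I = ∅ then (1 : ℝ) else 0) = 1 := by
  rw [Finset.sum_ite_eq', if_pos (Finset.empty_mem_powerset _)]

/-- `Σ_{I ⊆ s} 1[I = s] = 1`. [folklore] -/
theorem ite_self_sum (s : Finset ℤ) :
    ∑ I ∈ s.powerset, (if I = s then (1 : ℝ) else 0) = 1 := by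
  rw [Finset.sum_ite_eq', if_pos (Finset.mem_powerset_self _)]

/-- (M5) Lower bound of the level probability: `2^{#R+#C} P[level] ≥ 4 - 2(1+ρ̄^{r+1})^{4r} - (2ρ̄^{4r} +
4ρ̄^{2r})(1+ρ̄^{r-1})^{4r}` (the trivial character and the all-rows-all-columns character contribute `1` each).
[folklore] -/
theorem ZP_ge {p : ℝ} (hp0 : 0 ≤ p) (hp1 : p ≤ 1) {R C : Finset ℤ} {r : ℕ} (hR : #R = 2 * r + 1)
    (hC : #C = 2 * r + 1) {f : ℤ × ℤ} (hf : f ∈ R ×ˢ C) {X₀ : Finset (ℤ × ℤ)} (hX₀ : X₀ ⊆ R ×ˢ C) :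
    4 - 2 * (1 + |1 - 2 * p| ^ (r + 1)) ^ (4 * r)
      - (2 * |1 - 2 * p| ^ (4 * r) + 4 * |1 - 2 * p| ^ (2 * r)) *
        (1 + |1 - 2 * p| ^ (r - 1)) ^ (4 * r) ≤
      ∑ I ∈ R.powerset, ∑ J ∈ C.powerset, sg X₀ I J * (1 - 2 * p) ^ wN R C I J := by
  set ρ := 1 - 2 * p with hρ
  set ρa := |ρ| with hρa
  have h0 : 0 ≤ ρa := abs_nonneg ρ
  have h1 : ρa ≤ 1 := by rw [hρa, hρ]; exact abs_le.2 ⟨by linarith, by linarith⟩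
  have hlow : ∀ I J : Finset ℤ, ∀ w : ℕ, -ρa ^ w ≤ sg X₀ I J * ρ ^ w := by
    intro I J w
    have h := neg_abs_le (sg X₀ I J * ρ ^ w)
    rwa [abs_mul, abs_sg, one_mul, abs_pow] at h
  obtain ⟨hi₀, hj₀⟩ := Finset.mem_product.1 hf
  set R' := R.erase f.1 with hR'
  set C' := C.erase f.2 with hC'
  have hi : f.1 ∉ R' := Finset.notMem_erase f.1 R
  have hj : f.2 ∉ C' := Finset.notMem_erase f.2 C
  have hRi : insert f.1 R' = R := Finset.insert_erase hi₀
  have hCj : insert f.2 C' = C := Finset.insert_erase hj₀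
  have hR'c : #R' = 2 * r := by rw [hR', Finset.card_erase_of_mem hi₀, hR]; rfl
  have hC'c : #C' = 2 * r := by rw [hC', Finset.card_erase_of_mem hj₀, hC]; rfl
  rw [sum_powerset_insert₂ hRi hCj hi hj]
  set x := ρa ^ (r - 1) with hx
  set y := ρa ^ (r + 1) with hy
  have h44 : (1 + x) ^ #R' * (1 + x) ^ #C' = (1 + x) ^ (4 * r) := by
    rw [hR'c, hC'c, ← pow_add]; ring_nf
  have h44y : (1 + y) ^ #R' * (1 + y) ^ #C' = (1 + y) ^ (4 * r) := by
    rw [hR'c, hC'c, ← pow_add]; ring_nf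
  -- pointwise lower bound
  have key : ∀ I ∈ R'.powerset, ∀ J ∈ C'.powerset,
      (2 * ((if I = ∅ then (1 : ℝ) else 0) * (if J = ∅ then (1 : ℝ) else 0))
        - (y ^ (#I + #J) + ρa ^ (4 * r) * x ^ (#(R' \ I) + #(C' \ J))))
      + (-(ρa ^ (2 * r) * (x ^ (#I + #J) + x ^ (#(R' \ I) + #(C' \ J)))))
      + (-(ρa ^ (2 * r) * (x ^ (#I + #J) + x ^ (#(R' \ I) + #(C' \ J)))))
      + (2 * ((if I = R' then (1 : ℝ) else 0) * (if J = C' then (1 : ℝ) else 0))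
        - (y ^ (#(R' \ I) + #(C' \ J)) + ρa ^ (4 * r) * x ^ (#I + #J))) ≤
      sg X₀ I J * ρ ^ wN R C I J + sg X₀ I (insert f.2 J) * ρ ^ wN R C I (insert f.2 J) +
        sg X₀ (insert f.1 I) J * ρ ^ wN R C (insert f.1 I) J +
        sg X₀ (insert f.1 I) (insert f.2 J) * ρ ^ wN R C (insert f.1 I) (insert f.2 J) := by
    intro I hI J hJ
    have hIR' : I ⊆ R' := Finset.mem_powerset.1 hI
    have hJC' : J ⊆ C' := Finset.mem_powerset.1 hJ
    obtain ⟨w1, w2, w3, w4⟩ := wN_four hi₀ hj₀ hIR' hJC'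
    rw [← hR', ← hC'] at w1 w2 w3 w4
    have ha : #I + #(R' \ I) = 2 * r := by
      rw [add_comm, Finset.card_sdiff_add_card_eq_card hIR', hR'c]
    have hb : #J + #(C' \ J) = 2 * r := by
      rw [add_comm, Finset.card_sdiff_add_card_eq_card hJC', hC'c]
    -- F1
    have hF1 : 2 * ((if I = ∅ then (1 : ℝ) else 0) * (if J = ∅ then (1 : ℝ) else 0))
        - (y ^ (#I + #J) + ρa ^ (4 * r) * x ^ (#(R' \ I) + #(C' \ J))) ≤
        sg X₀ I J * ρ ^ wN R C I J := by
      by_cases hIJ : I = ∅ ∧ J = ∅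
      · obtain ⟨rfl, rfl⟩ := hIJ
        have hw : wN R C ∅ ∅ = 0 := by rw [w1]; simp
        have hs : sg X₀ ∅ ∅ = 1 := by simp [sg]
        rw [hw, hs]
        simp only [if_true, Finset.card_empty, add_zero, pow_zero, mul_one]
        have : 0 ≤ ρa ^ (4 * r) * x ^ (#(R' \ ∅) + #(C' \ ∅)) := by positivity
        linarith
      · have hz : (if I = ∅ then (1 : ℝ) else 0) * (if J = ∅ then (1 : ℝ) else 0) = 0 := by
          split_ifs with h1 h2 <;> simp_all
        rw [hz, mul_zero, zero_sub, w1]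
        have e := pw1 h0 h1 ha hb
        have hl := hlow I J (#I * (#(C' \ J) + 1) + (#(R' \ I) + 1) * #J)
        linarith
    -- F4
    have hF4 : 2 * ((if I = R' then (1 : ℝ) else 0) * (if J = C' then (1 : ℝ) else 0))
        - (y ^ (#(R' \ I) + #(C' \ J)) + ρa ^ (4 * r) * x ^ (#I + #J)) ≤
        sg X₀ (insert f.1 I) (insert f.2 J) * ρ ^ wN R C (insert f.1 I) (insert f.2 J) := by
      by_cases hIJ : I = R' ∧ J = C'
      · obtain ⟨rfl, rfl⟩ := hIJ
        rw [hRi, hCj]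
        have hw : wN R C R C = 0 := by
          rw [wN_eq R C (subset_refl R) (subset_refl C)]; simp
        have hs : sg X₀ R C = 1 := prod_rsign_mul_prod_csign R C hX₀
        rw [hw, hs]
        simp only [if_true, Finset.sdiff_self, Finset.card_empty, add_zero, pow_zero, mul_one]
        have : 0 ≤ ρa ^ (4 * r) * x ^ (#(R.erase f.1) + #(C.erase f.2)) := by positivity
        linarith
      · have hz : (if I = R' then (1 : ℝ) else 0) * (if J = C' then (1 : ℝ) else 0) = 0 := by
          split_ifs with h1 h2 <;> simp_all
        rw [hz, mul_zero, zero_sub, w4]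
        have e := pw1 h0 h1 (by omega : #(R' \ I) + #I = 2 * r) (by omega : #(C' \ J) + #J = 2 * r)
        rw [show #(R' \ I) * (#J + 1) + (#I + 1) * #(C' \ J) =
          (#I + 1) * #(C' \ J) + #(R' \ I) * (#J + 1) by ring] at e
        have hl := hlow (insert f.1 I) (insert f.2 J) ((#I + 1) * #(C' \ J) + #(R' \ I) * (#J + 1))
        linarith
    -- F2
    have hF2 : -(ρa ^ (2 * r) * (x ^ (#I + #J) + x ^ (#(R' \ I) + #(C' \ J)))) ≤
        sg X₀ (insert f.1 I) J * ρ ^ wN R C (insert f.1 I) J := by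
      rw [w2]
      have e := pw2 h0 h1 ha hb
      have hl := hlow (insert f.1 I) J ((#I + 1) * (#(C' \ J) + 1) + #(R' \ I) * #J)
      have hm : ρa ^ ((#I + 1) * (#(C' \ J) + 1) + #(R' \ I) * #J) ≤
          ρa ^ ((#I + 1) * (#(C' \ J) + 1) + #(R' \ I) * #J - 1) :=
        pow_le_pow_of_le_one h0 h1 (Nat.sub_le _ _)
      linarith
    -- F3
    have hF3 : -(ρa ^ (2 * r) * (x ^ (#I + #J) + x ^ (#(R' \ I) + #(C' \ J)))) ≤
        sg X₀ I (insert f.2 J) * ρ ^ wN R C I (insert f.2 J) := by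
      rw [w3]
      have e := pw2 h0 h1 hb ha
      rw [show (#J + 1) * (#(R' \ I) + 1) + #(C' \ J) * #I =
        #I * #(C' \ J) + (#(R' \ I) + 1) * (#J + 1) by ring, add_comm #J #I,
        add_comm #(C' \ J) #(R' \ I)] at e
      have hl := hlow I (insert f.2 J) (#I * #(C' \ J) + (#(R' \ I) + 1) * (#J + 1))
      have hm : ρa ^ (#I * #(C' \ J) + (#(R' \ I) + 1) * (#J + 1)) ≤
          ρa ^ (#I * #(C' \ J) + (#(R' \ I) + 1) * (#J + 1) - 1) :=
        pow_le_pow_of_le_one h0 h1 (Nat.sub_le _ _)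
      linarith
    linarith
  refine le_trans (le_of_eq ?_) (Finset.sum_le_sum fun I hI => Finset.sum_le_sum fun J hJ => key I hI J hJ)
  -- evaluate the lower-bound sum
  simp only [Finset.sum_add_distrib, Finset.sum_sub_distrib, Finset.sum_neg_distrib, mul_add,
    ← Finset.mul_sum, ite_empty_sum, ite_self_sum, mul_one, sum_sum_pow, sum_sum_pow_sdiff, h44, h44y]
  ring

end SyndromeBias

end Summit.CriticalPhenomena.CardyFormulaZ2.Theorems.CornerLineDescent.SymmetricSeed
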